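import Summits.Ventures.PercRepro.RankLevelSetCoreSevenLargeCorankArith

/-!
# PercRepro — THE LARGE-CORANK INEQUALITY OF LEVEL `7` AT RANK `36`: corank `≥ 168` (p8, gen 24; a feeder for S4 — the
`q = 7` window, the row `36`)

p2 g34's `largeSeven_all` (RankLevelSetCoreSevenLargeCorankArith) proves the large-corank inequality
`2^{p+79}·C(n, 7)/C(p+7, 7) + R₇(n) ≤ Σ_{7 ≤ k ≤ p−1} C(n, k)` for every `p ≥ 73` and `n ≥ p + 91` from the base `(73, 164)`
by its two steps; the step in `n` (`largeSeven_step_n`) is generic in `p`. At `p = 36` the same inequality holds from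
`n = 204` (the `(p, D₀)` floor `36 / 168`): **`largeSeven_base36`** is the base `(36, 204)` by `norm_num`,
**`largeSeven_all36`** every `n ≥ 204` by the step in `n`. Axioms: standard.
-/

set_option exponentiation.threshold 1024

namespace PercRepro

namespace ThmN

/-- **The base `(p, n) = (36, 204)`** of the large-corank inequality at rank `36`. -/
theorem largeSeven_base36 :
    (2 : ℚ) ^ (36 + 79) * ((36 + 168).choose 7 : ℚ) / ((36 + 7).choose 7 : ℚ) +
    (((36 + 168).choose 7 * 2 ^ 72 + (36 + 168).choose 6 * 2 ^ 33 + (36 + 168).choose 5 * 2 ^ 14 + (36 + 168).choose 4 * 2 ^ 6 +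
      (36 + 168).choose 3 * 2 ^ 3 + (36 + 168).choose 2 * 2 + (36 + 168) + 1 : ℕ) : ℚ) ≤
    ((∑ k ∈ Finset.Ico 7 36, (36 + 168).choose k : ℕ) : ℚ) := by
  rw [Finset.sum_Ico_eq_sum_range]
  simp only [Finset.sum_range_succ, Finset.sum_range_zero, Nat.choose_eq_descFactorial_div_factorial]
  norm_num

/-- **The large-corank inequality at rank `36` for every `n ≥ 204`** (the base `(36, 204)`, p2's step in `n`). -/
theorem largeSeven_all36 (n : ℕ) (hn : 36 + 168 ≤ n) :
    (2 : ℚ) ^ (36 + 79) * (n.choose 7 : ℚ) / ((36 + 7).choose 7 : ℚ) +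
    ((n.choose 7 * 2 ^ 72 + n.choose 6 * 2 ^ 33 + n.choose 5 * 2 ^ 14 + n.choose 4 * 2 ^ 6 +
      n.choose 3 * 2 ^ 3 + n.choose 2 * 2 + n + 1 : ℕ) : ℚ) ≤
    ((∑ k ∈ Finset.Ico 7 36, n.choose k : ℕ) : ℚ) := by
  induction n, hn using Nat.le_induction with
  | base => exact largeSeven_base36
  | succ n hn ih => exact largeSeven_step_n 36 n (by omega) ih

end ThmN

end PercRepro
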